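import Summits.KontsevichZagierPeriods.KontsevichZagierPeriods.Theses.IsogenyCertificates
import Summits.KontsevichZagierPeriods.KontsevichZagierPeriods.Theorems.HermiteRigidityCMTwistQuasiPeriodTransferMoves
import Literature.NumberTheory.Transcendental.KZCalculus
import Literature.NumberTheory.Transcendental.KZRelationsLE
import Literature.NumberTheory.Transcendental.KZSemialgebraicComplex
import Literature.NumberTheory.Transcendental.SemialgebraicMapsProofs

/-!
# `RealPeriodSectorComplete` (stmt-KontsevichZagierPeriods-5381), line `period-ratio-branch-cov` — stub `stub_unboundedReduction`

Reduction of the real-sector representation `[{P > 0}, a/√P]`, `P = x³ + Ax + B` nonsingular over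
`ℤ`, to its UNBOUNDED component `[(e, ∞), c/√P]`, `e` the largest real root of `P`, by the moves of
the Kontsevich–Zagier calculus (`Literature.NumberTheory.Transcendental.KZ`):

* §1 real roots of the depressed cubic (largest root by `sSup` + IVT, positivity beyond it, the
  dichotomy one root / three roots `e₁ < e₂ < e` for `4p³ + 27q² ≠ 0`, algebraicity);
* §2 the Möbius involution `Φ(x) = e₁ + K/(x − e₁)`, `K = (e₁ − e₂)(e₁ − e)` (translation by
  the `2`-torsion point `(e₁, 0)`, read on `x`: `P(Φ x) = K² P(x)/(x − e₁)⁴`,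
  `|Φ'(x)| = K/(x − e₁)²`), giving ONE change of variables
  `[(e, ∞), a/√P] − [(e₁, e₂), a/√P] ∈ changeOfVariablesRel` (via the tree's dimension-one
  rule-2 wrapper `CMTwistQuasiPeriodTransfer.of_sub_of_mem_changeOfVariablesRel_dimOne`);
* §3 three real roots: `{P > 0} = (e₁, e₂) ∪ (e, ∞)`, domain additivity + §2 + integrand
  additivity give `[{P > 0}, a/√P] ~ [(e, ∞), 2a/√P]`; §4 the stub (`c = a` or `c = 2a`).
-/

noncomputable section

open MeasureTheory Set Filter
open Literature.ModelTheory.ExponentialFields (IsSemialgebraic isSemialgebraic_setOf_eval_eq_zero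
  isSemialgebraic_setOf_eval_pos isSemialgebraic_univ)
open Literature.NumberTheory.Transcendental
open Literature.NumberTheory.Transcendental.KZ
open Summit.KontsevichZagierPeriods.HermiteRigidity.CMTwistQuasiPeriodTransfer
  (of_sub_of_mem_changeOfVariablesRel_dimOne isSemialgebraic_setOf_apply_lt_of_isAlgebraic
    isSemialgebraic_setOf_apply_gt_of_isAlgebraic)

namespace Summit.KontsevichZagierPeriods.IsogenyCertificates.RealPeriodSectorCompleteStubs.UnboundedReduction

/-! ## §1 Real roots of the depressed cubic `t³ + p t + q` -/

/-- For `t > |p| + |q| + 1` the cubic `t³ + pt + q` is positive. [folklore] -/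
theorem cubic_pos_of_lt {p q t : ℝ} (ht : |p| + |q| + 1 < t) : 0 < t ^ 3 + p * t + q := by
  have hp := neg_abs_le p
  have hq := neg_abs_le q
  have h0 : 0 ≤ |p| := abs_nonneg p
  have h1 : 0 ≤ |q| := abs_nonneg q
  nlinarith [mul_nonneg (mul_nonneg (by linarith : (0 : ℝ) ≤ t) (by linarith : (0 : ℝ) ≤ t))
    (by linarith : (0 : ℝ) ≤ t - 1), mul_nonneg (by linarith : (0 : ℝ) ≤ t)
    (by linarith : (0 : ℝ) ≤ t - (|p| + |q| + 1)), mul_nonneg (by linarith : (0 : ℝ) ≤ p + |p|)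
    (by linarith : (0 : ℝ) ≤ t)]

/-- For `t < -(|p| + |q| + 1)` the cubic `t³ + pt + q` is negative. [folklore] -/
theorem cubic_neg_of_lt {p q t : ℝ} (ht : t < -(|p| + |q| + 1)) : t ^ 3 + p * t + q < 0 := by
  have h := cubic_pos_of_lt (p := p) (q := -q) (t := -t) (by rw [abs_neg]; linarith)
  have h' : (-t) ^ 3 + p * (-t) + (-q) = -(t ^ 3 + p * t + q) := by ring
  rw [h'] at h
  linarith

/-- The depressed cubic has a LARGEST real root (IVT for existence; the root set is closed and
bounded above). [folklore] -/
theorem exists_max_root (p q : ℝ) :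
    ∃ e : ℝ, e ^ 3 + p * e + q = 0 ∧ ∀ t : ℝ, t ^ 3 + p * t + q = 0 → t ≤ e := by
  have hcont : Continuous fun t : ℝ => t ^ 3 + p * t + q := by fun_prop
  have hbdd : BddAbove {t : ℝ | t ^ 3 + p * t + q = 0} := by
    refine ⟨|p| + |q| + 1, fun t ht => ?_⟩
    by_contra h
    have h1 := cubic_pos_of_lt (not_le.mp h)
    have h2 : t ^ 3 + p * t + q = 0 := ht
    linarith
  have hne : ({t : ℝ | t ^ 3 + p * t + q = 0}).Nonempty := by
    have hM : (0 : ℝ) ≤ |p| + |q| + 1 := by positivity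
    obtain ⟨t, _, ht⟩ := intermediate_value_Icc (show -(|p| + |q| + 2) ≤ |p| + |q| + 2 by linarith)
      hcont.continuousOn ⟨(cubic_neg_of_lt (by linarith)).le, (cubic_pos_of_lt (by linarith)).le⟩
    exact ⟨t, ht⟩
  have hclosed : IsClosed {t : ℝ | t ^ 3 + p * t + q = 0} := isClosed_eq hcont continuous_const
  exact ⟨sSup {t : ℝ | t ^ 3 + p * t + q = 0}, hclosed.csSup_mem hne hbdd,
    fun t ht => le_csSup hbdd ht⟩

/-- Beyond its largest real root the cubic is positive (IVT). [folklore] -/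
theorem cubic_pos_of_max_root {p q e : ℝ} (hmax : ∀ t : ℝ, t ^ 3 + p * t + q = 0 → t ≤ e)
    {t : ℝ} (ht : e < t) : 0 < t ^ 3 + p * t + q := by
  by_contra h
  have h' : t ^ 3 + p * t + q ≤ 0 := not_lt.mp h
  have hcont : Continuous fun t : ℝ => t ^ 3 + p * t + q := by fun_prop
  have htb : t ≤ max t (|p| + |q| + 1) + 1 := by linarith [le_max_left t (|p| + |q| + 1)]
  obtain ⟨s, hs, hs0⟩ := intermediate_value_Icc htb hcont.continuousOn
    ⟨h', (cubic_pos_of_lt (by linarith [le_max_right t (|p| + |q| + 1)])).le⟩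
  have := hmax s hs0
  linarith [hs.1]

/-- **Root dichotomy** for a nonsingular depressed cubic (`4p³ + 27q² ≠ 0`) with largest root `e`:
either `{P > 0} = (e, ∞)` (one real root), or `P = (t − e₁)(t − e₂)(t − e)` with
`e₁ < e₂ < e` (three real roots). Via `P(t) = (t − e)(t² + et + e² + p)` and the sign of the
discriminant `−3e² − 4p` of the quadratic factor; a double root forces `4p³ + 27q² = 0`.
[folklore] -/
theorem roots_dichotomy {p q e : ℝ} (hΔ : 4 * p ^ 3 + 27 * q ^ 2 ≠ 0) (he : e ^ 3 + p * e + q = 0)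
    (hmax : ∀ t : ℝ, t ^ 3 + p * t + q = 0 → t ≤ e) :
    (∀ t : ℝ, 0 < t ^ 3 + p * t + q ↔ e < t) ∨
    ∃ e₁ e₂ : ℝ, e₁ < e₂ ∧ e₂ < e ∧
      ∀ t : ℝ, t ^ 3 + p * t + q = (t - e₁) * (t - e₂) * (t - e) := by
  have hfac : ∀ t : ℝ, t ^ 3 + p * t + q = (t - e) * (t ^ 2 + e * t + (e ^ 2 + p)) := fun t => by
    linear_combination he
  rcases lt_trichotomy (-3 * e ^ 2 - 4 * p) 0 with hDneg | hD0 | hDpos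
  · left
    intro t
    have hQ : 0 < t ^ 2 + e * t + (e ^ 2 + p) := by nlinarith [sq_nonneg (2 * t + e)]
    rw [hfac]
    constructor
    · intro h
      by_contra hle
      have : (t - e) * (t ^ 2 + e * t + (e ^ 2 + p)) ≤ 0 :=
        mul_nonpos_of_nonpos_of_nonneg (by linarith [not_lt.mp hle]) hQ.le
      linarith
    · intro h
      exact mul_pos (by linarith) hQ
  · exfalso
    apply hΔ
    have hp : p = -3 * e ^ 2 / 4 := by linarith
    have hq : q = -e ^ 3 - p * e := by linarith
    rw [hq, hp]
    ring
  · right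
    have hs : 0 < Real.sqrt (-3 * e ^ 2 - 4 * p) := Real.sqrt_pos.2 hDpos
    have hss : Real.sqrt (-3 * e ^ 2 - 4 * p) ^ 2 = -3 * e ^ 2 - 4 * p := Real.sq_sqrt hDpos.le
    refine ⟨(-e - Real.sqrt (-3 * e ^ 2 - 4 * p)) / 2, (-e + Real.sqrt (-3 * e ^ 2 - 4 * p)) / 2,
      by linarith, ?_, ?_⟩
    · have hroot : ((-e + Real.sqrt (-3 * e ^ 2 - 4 * p)) / 2) ^ 3 +
          p * ((-e + Real.sqrt (-3 * e ^ 2 - 4 * p)) / 2) + q = 0 := by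
        rw [hfac]
        have : ((-e + Real.sqrt (-3 * e ^ 2 - 4 * p)) / 2) ^ 2 +
            e * ((-e + Real.sqrt (-3 * e ^ 2 - 4 * p)) / 2) + (e ^ 2 + p) = 0 := by
          linear_combination (1 / 4 : ℝ) * hss
        rw [this, mul_zero]
      rcases (hmax _ hroot).lt_or_eq with hlt | heq
      · exact hlt
      · exfalso
        apply hΔ
        have hs3 : Real.sqrt (-3 * e ^ 2 - 4 * p) = 3 * e := by linarith
        rw [hs3] at hss
        have hp : p = -3 * e ^ 2 := by linarith
        have hq : q = -e ^ 3 - p * e := by linarith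
        rw [hq, hp]
        ring
    · intro t
      rw [hfac]
      linear_combination ((t - e) / 4) * hss

/-- Sign of a product of three ordered linear factors: for `a < b < c`,
`(t − a)(t − b)(t − c) > 0 ↔ t ∈ (a, b) ∪ (c, ∞)`. [folklore] -/
theorem prod_three_pos_iff {a b c t : ℝ} (hab : a < b) (hbc : b < c) :
    0 < (t - a) * (t - b) * (t - c) ↔ (a < t ∧ t < b) ∨ c < t := by
  refine ⟨fun h => ?_, ?_⟩
  · by_contra hn
    simp only [not_or, not_and, not_lt] at hn
    rcases le_or_gt t a with hta | hta
    · have : (t - a) * (t - b) * (t - c) ≤ 0 := mul_nonpos_of_nonneg_of_nonpos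
        (mul_nonneg_of_nonpos_of_nonpos (by linarith) (by linarith)) (by linarith)
      linarith
    · have : (t - a) * (t - b) * (t - c) ≤ 0 := mul_nonpos_of_nonneg_of_nonpos
        (mul_nonneg (by linarith) (by linarith [hn.1 hta])) (by linarith [hn.2])
      linarith
  · rintro (⟨hat, htb⟩ | hct)
    · have := mul_pos (mul_pos (sub_pos.2 hat) (sub_pos.2 htb)) (sub_pos.2 (htb.trans hbc))
      linarith [show (t - a) * (t - b) * (t - c) = (t - a) * (b - t) * (c - t) by ring]
    · exact mul_pos (mul_pos (by linarith) (by linarith)) (by linarith)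

/-- A real root of `t³ + At + B` (`A, B ∈ ℤ`) is algebraic over `ℚ`. [folklore] -/
theorem isAlgebraic_of_cubic_root {A B : ℤ} {t : ℝ} (ht : t ^ 3 + (A : ℝ) * t + (B : ℝ) = 0) :
    IsAlgebraic ℚ t := by
  refine ⟨Polynomial.X ^ 3 + Polynomial.C (A : ℚ) * Polynomial.X + Polynomial.C (B : ℚ), ?_, ?_⟩
  · intro h
    have h3 := congrArg (fun f : Polynomial ℚ => f.coeff 3) h
    simp only [Polynomial.coeff_add, Polynomial.coeff_X_pow, Polynomial.coeff_C_mul,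
      Polynomial.coeff_X, Polynomial.coeff_C, Polynomial.coeff_zero] at h3
    norm_num at h3
  · simp only [map_add, map_mul, map_pow, Polynomial.aeval_X, Polynomial.aeval_C, eq_ratCast,
      Rat.cast_intCast]
    exact ht

/-! ## §2 The Möbius involution `Φ(t) = e₁ + K/(t − e₁)`, `K = (e₁ − e₂)(e₁ − e)` -/

/-- `Φ(t) − e₂ = (e₁ − e₂)(t − e)/(t − e₁)`. [folklore] -/
theorem moebius_sub_two {e₁ e₂ e K t : ℝ} (hK : K = (e₁ - e₂) * (e₁ - e)) (ht : t - e₁ ≠ 0) :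
    e₁ + K * (t - e₁)⁻¹ - e₂ = (e₁ - e₂) * (t - e) / (t - e₁) := by
  subst hK
  field_simp
  ring

/-- `Φ(t) − e = (e₁ − e)(t − e₂)/(t − e₁)`. [folklore] -/
theorem moebius_sub_three {e₁ e₂ e K t : ℝ} (hK : K = (e₁ - e₂) * (e₁ - e)) (ht : t - e₁ ≠ 0) :
    e₁ + K * (t - e₁)⁻¹ - e = (e₁ - e) * (t - e₂) / (t - e₁) := by
  subst hK
  field_simp
  ring

/-- `P(Φ t) = (K/(t − e₁)²)² · P(t)` for `P = (t − e₁)(t − e₂)(t − e)`. [folklore] -/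
theorem moebius_cubic {e₁ e₂ e K t : ℝ} (hK : K = (e₁ - e₂) * (e₁ - e)) (ht : t - e₁ ≠ 0) :
    (e₁ + K * (t - e₁)⁻¹ - e₁) * (e₁ + K * (t - e₁)⁻¹ - e₂) * (e₁ + K * (t - e₁)⁻¹ - e) =
      (K / (t - e₁) ^ 2) ^ 2 * ((t - e₁) * (t - e₂) * (t - e)) := by
  subst hK
  field_simp
  ring

/-- `Φ` is an involution: `Φ(Φ t) = t`. [folklore] -/
theorem moebius_moebius {e₁ K : ℝ} (hK : K ≠ 0) (t : ℝ) :
    e₁ + K * (e₁ + K * (t - e₁)⁻¹ - e₁)⁻¹ = t := by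
  have h1 : e₁ + K * (t - e₁)⁻¹ - e₁ = K * (t - e₁)⁻¹ := by ring
  rw [h1, mul_inv, inv_inv, ← mul_assoc, mul_inv_cancel₀ hK, one_mul]
  ring

/-- **The egg is one change of variables away from the unbounded piece.** For
`P = (t − e₁)(t − e₂)(t − e)` with algebraic `e₁ < e₂ < e`:
`[(e, ∞), a/√P] − [(e₁, e₂), a/√P] ∈ changeOfVariablesRel`, along the Möbius involution
`Φ(x) = e₁ + K/(x − e₁)`, `K = (e₁ − e₂)(e₁ − e) > 0`, a bijection `(e, ∞) → (e₁, e₂)` with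
`P(Φ x) = K² P(x)/(x − e₁)⁴`, `|Φ'(x)| = K/(x − e₁)²`, so `a/√P(x) = a/√P(Φ x) · |Φ'(x)|`
(translation by the `2`-torsion point `(e₁, 0)` of `y² = P(x)`). [folklore] -/
theorem of_sub_of_mem_changeOfVariablesRel {A B : ℤ} {a : ℚ} {e₁ e₂ e : ℝ} (h12 : e₁ < e₂)
    (h2e : e₂ < e)
    (hfac : ∀ t : ℝ, t ^ 3 + (A : ℝ) * t + (B : ℝ) = (t - e₁) * (t - e₂) * (t - e))
    (he₁ : IsAlgebraic ℚ e₁) (he₂ : IsAlgebraic ℚ e₂) (he : IsAlgebraic ℚ e)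
    {rU rE : IntegralRep 1} (hdU : rU.domain = {x | e < x 0})
    (hdE : rE.domain = {x | e₁ < x 0 ∧ x 0 < e₂})
    (hiU : EqOn rU.integrand (fun x => (a : ℝ) / Real.sqrt (x 0 ^ 3 + (A : ℝ) * x 0 + (B : ℝ)))
      rU.domain)
    (hiE : EqOn rE.integrand (fun x => (a : ℝ) / Real.sqrt (x 0 ^ 3 + (A : ℝ) * x 0 + (B : ℝ)))
      rE.domain) :
    KZ.of rU - KZ.of rE ∈ changeOfVariablesRel := by
  obtain ⟨K, hK⟩ : ∃ K : ℝ, K = (e₁ - e₂) * (e₁ - e) := ⟨_, rfl⟩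
  have hKpos : 0 < K := by rw [hK]; exact mul_pos_of_neg_of_neg (by linarith) (by linarith)
  have hKalg : IsAlgebraic ℚ K := by rw [hK]; exact (he₁.sub he₂).mul (he₁.sub he)
  -- pointwise facts on `(e, ∞)`
  have hne : ∀ t : ℝ, e < t → t - e₁ ≠ 0 := fun t ht => by
    have : 0 < t - e₁ := by linarith
    exact this.ne'
  have hmaps : ∀ t : ℝ, e < t → e₁ < e₁ + K * (t - e₁)⁻¹ ∧ e₁ + K * (t - e₁)⁻¹ < e₂ := by
    intro t ht
    have ht1 : 0 < t - e₁ := by linarith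
    constructor
    · have : 0 < K * (t - e₁)⁻¹ := mul_pos hKpos (inv_pos.2 ht1)
      linarith
    · have h := moebius_sub_two (e₂ := e₂) hK (hne t ht)
      have hnum : (e₁ - e₂) * (t - e) / (t - e₁) < 0 :=
        div_neg_of_neg_of_pos (mul_neg_of_neg_of_pos (by linarith) (by linarith)) ht1
      linarith
  refine of_sub_of_mem_changeOfVariablesRel_dimOne rU rE (fun t => e₁ + K * (t - e₁)⁻¹)
    (fun t => -(K / (t - e₁) ^ 2)) ?_ ?_ ?_ ?_ ?_
  · -- `Φ` is `ℚ`-semialgebraic on `(e, ∞)`: built from the algebraic constants `e₁`, `K`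
    have hsU : IsSemialgebraic ℚ rU.domain := rU.isSemialgebraic_domain
    have h1 : IsSemialgebraicFunOn ℚ rU.domain (fun _ => e₁) :=
      isSemialgebraicFunOn_const_of_isAlgebraic hsU he₁
    have h2 : IsSemialgebraicFunOn ℚ rU.domain (fun x => x 0 - e₁) :=
      ((isSemialgebraicFunOn_aeval hsU (MvPolynomial.X 0)).congr fun x _ => by simp).fun_sub h1
    have h3 : IsSemialgebraicFunOn ℚ rU.domain (fun x => (x 0 - e₁)⁻¹) :=
      h2.inv fun x hx => hne (x 0) (by rw [hdU] at hx; exact hx)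
    exact h1.fun_add ((isSemialgebraicFunOn_const_of_isAlgebraic hsU hKalg).fun_mul h3)
  · -- derivative
    intro x hx
    rw [hdU] at hx
    have h1 : HasDerivAt (fun t : ℝ => t - e₁) 1 (x 0) := (hasDerivAt_id (x 0)).sub_const e₁
    have h2 : HasDerivAt (fun t : ℝ => e₁ + K * (t - e₁)⁻¹) (K * (-1 / (x 0 - e₁) ^ 2)) (x 0) :=
      ((h1.inv (hne (x 0) hx)).const_mul K).const_add e₁
    exact h2.congr_deriv (by ring)
  · -- injectivity
    intro x hx y hy hxy
    rw [hdU] at hx hy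
    have h1 : (x 0 - e₁)⁻¹ = (y 0 - e₁)⁻¹ := mul_left_cancel₀ hKpos.ne' (add_left_cancel hxy)
    have := inv_inj.mp h1
    linarith
  · -- the image is the egg
    rw [hdE, hdU]
    ext y
    simp only [mem_setOf_eq, mem_image]
    constructor
    · rintro ⟨hy1, hy2⟩
      have hyne : y 0 - e₁ ≠ 0 := (sub_pos.2 hy1).ne'
      refine ⟨fun _ => e₁ + K * (y 0 - e₁)⁻¹, ?_, ?_⟩
      · have h := moebius_sub_three (e₂ := e₂) (e := e) hK hyne
        have hpos : 0 < (e₁ - e) * (y 0 - e₂) / (y 0 - e₁) :=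
          div_pos (mul_pos_of_neg_of_neg (by linarith) (by linarith)) (sub_pos.2 hy1)
        show e < e₁ + K * (y 0 - e₁)⁻¹
        linarith
      · funext i
        rw [Fin.fin_one_eq_zero i]
        exact moebius_moebius hKpos.ne' (y 0)
    · rintro ⟨x, hx, rfl⟩
      exact hmaps (x 0) hx
  · -- the integrand identity `a/√P(x) = a/√P(Φ x) · |Φ'(x)|`
    intro x hx
    have hxU := hx
    rw [hdU] at hx
    have hx' : e < x 0 := hx
    have ht := hne (x 0) hx'
    have hΦE : (fun _ => e₁ + K * (x 0 - e₁)⁻¹ : Fin 1 → ℝ) ∈ rE.domain := by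
      rw [hdE]; exact hmaps (x 0) hx'
    have hu : 0 < K / (x 0 - e₁) ^ 2 := div_pos hKpos (pow_pos (sub_pos.2 (by linarith)) 2)
    rw [hiU hxU, hiE hΦE, abs_neg, abs_of_pos hu]
    dsimp only
    have hP : 0 < (x 0 - e₁) * (x 0 - e₂) * (x 0 - e) :=
      mul_pos (mul_pos (by linarith) (by linarith)) (by linarith)
    rw [hfac, hfac, moebius_cubic hK ht, Real.sqrt_mul (sq_nonneg _), Real.sqrt_sq hu.le]
    have hsq : 0 < Real.sqrt ((x 0 - e₁) * (x 0 - e₂) * (x 0 - e)) := Real.sqrt_pos.2 hP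
    field_simp

/-! ## §3 Three real roots: the chain of three moves -/

/-- **Three real roots.** If `P = (t − e₁)(t − e₂)(t − e)` with `e₁ < e₂ < e`, then
`[{P > 0}, a/√P] ~ [(e, ∞), 2a/√P]`: domain additivity `{P > 0} = (e₁, e₂) ⊔ (e, ∞)`
(`domainAddRel`), the egg is the unbounded piece after one change of variables
(`of_sub_of_mem_changeOfVariablesRel`), and the two copies of `[(e, ∞), a/√P]` merge by integrand
additivity (`integrandAddRel`, `IntegralRep.constMul 2`). [folklore] -/
theorem exists_reduction_of_three_roots {A B : ℤ} {a : ℚ} {e₁ e₂ e : ℝ} (h12 : e₁ < e₂)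
    (h2e : e₂ < e)
    (hfac : ∀ t : ℝ, t ^ 3 + (A : ℝ) * t + (B : ℝ) = (t - e₁) * (t - e₂) * (t - e))
    (r : IntegralRep 1) (hd : r.domain = {x | 0 < x 0 ^ 3 + (A : ℝ) * x 0 + (B : ℝ)})
    (hi : EqOn r.integrand (fun x => (a : ℝ) / Real.sqrt (x 0 ^ 3 + (A : ℝ) * x 0 + (B : ℝ)))
      r.domain) :
    ∃ r₁ : IntegralRep 1, r₁.domain = {x | e < x 0} ∧
      EqOn r₁.integrand (fun x => ((2 * a : ℚ) : ℝ) / Real.sqrt (x 0 ^ 3 + (A : ℝ) * x 0 + (B : ℝ)))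
        r₁.domain ∧ Equivalent r r₁ := by
  -- the three roots are algebraic
  have he₁ : IsAlgebraic ℚ e₁ := isAlgebraic_of_cubic_root (A := A) (B := B) (by rw [hfac]; ring)
  have he₂ : IsAlgebraic ℚ e₂ := isAlgebraic_of_cubic_root (A := A) (B := B) (by rw [hfac]; ring)
  have he : IsAlgebraic ℚ e := isAlgebraic_of_cubic_root (A := A) (B := B) (by rw [hfac]; ring)
  -- the two pieces of `{P > 0}`
  have hunb : IsSemialgebraic ℚ {x : Fin 1 → ℝ | e < x 0} :=
    isSemialgebraic_setOf_apply_gt_of_isAlgebraic he 0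
  have hegg : IsSemialgebraic ℚ {x : Fin 1 → ℝ | e₁ < x 0 ∧ x 0 < e₂} :=
    (isSemialgebraic_setOf_apply_gt_of_isAlgebraic he₁ 0).inter
      (isSemialgebraic_setOf_apply_lt_of_isAlgebraic he₂ 0)
  have hσ : r.domain = {x : Fin 1 → ℝ | e₁ < x 0 ∧ x 0 < e₂} ∪ {x | e < x 0} := by
    rw [hd]
    ext x
    simp only [mem_setOf_eq, mem_union]
    rw [hfac]
    exact prod_three_pos_iff h12 h2e
  have hEsub : {x : Fin 1 → ℝ | e₁ < x 0 ∧ x 0 < e₂} ⊆ r.domain := hσ ▸ subset_union_left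
  have hUsub : {x : Fin 1 → ℝ | e < x 0} ⊆ r.domain := hσ ▸ subset_union_right
  set rE : IntegralRep 1 := r.restrict _ hegg hEsub with hrE
  set rU : IntegralRep 1 := r.restrict _ hunb hUsub with hrU
  have h2 : IsAlgebraic ℚ (2 : ℝ) := by
    simpa using isAlgebraic_algebraMap (R := ℚ) (A := ℝ) 2
  set rU2 : IntegralRep 1 := rU.constMul 2 h2 with hrU2
  have hiU : EqOn rU.integrand (fun x => (a : ℝ) / Real.sqrt (x 0 ^ 3 + (A : ℝ) * x 0 + (B : ℝ)))
      rU.domain := fun x hx => hi (hUsub hx)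
  -- move (1a): domain additivity
  have m1 : KZ.of r - KZ.of rE - KZ.of rU ∈ domainAddRel := by
    refine ⟨1, r, rE, rU, hσ, ?_, fun _ _ => rfl, fun _ _ => rfl, rfl⟩
    have hempty : rE.domain ∩ rU.domain = ∅ := by
      ext x
      simp only [hrE, hrU, IntegralRep.domain_restrict, mem_inter_iff, mem_setOf_eq,
        mem_empty_iff_false, iff_false, not_and]
      intro hx hxe
      linarith [hx.2]
    rw [hempty, measure_empty]
  -- move (2): the change of variables along the Möbius involution
  have m2 : KZ.of rU - KZ.of rE ∈ changeOfVariablesRel :=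
    of_sub_of_mem_changeOfVariablesRel h12 h2e hfac he₁ he₂ he rfl rfl hiU fun x hx => hi (hEsub hx)
  -- move (1b): integrand additivity `2f = f + f`
  have m3 : KZ.of rU2 - KZ.of rU - KZ.of rU ∈ integrandAddRel :=
    ⟨1, rU2, rU, rU, rfl, rfl, fun x _ => by simp [hrU2, two_mul], rfl⟩
  refine ⟨rU2, rfl, fun x hx => ?_, ?_⟩
  · have hx' : x ∈ rU.domain := hx
    simp only [hrU2, IntegralRep.integrand_constMul]
    rw [hiU hx']
    push_cast
    ring
  · have h := relations.sub_mem (relations.sub_mem (domainAddRel_subset_relations m1)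
      (changeOfVariablesRel_subset_relations m2)) (integrandAddRel_subset_relations m3)
    unfold Equivalent
    convert h using 1
    abel

/-! ## §4 The stub -/

/-- **STUB `stub_unboundedReduction`** (line `period-ratio-branch-cov` of crux
`RealPeriodSectorComplete`): the real-sector representation `[{P > 0}, a/√P]` of a nonsingular
`y² = P(x) = x³ + Ax + B` over `ℤ` is KZ-equivalent to `[(e, ∞), c/√P]`, `e` the largest real root
of `P`, `c = a` (one real root, no move) or `c = 2a` (three real roots, three moves:
`exists_reduction_of_three_roots`). [folklore] -/
theorem stub_unboundedReduction : ∀ (A B : ℤ), 4 * A ^ 3 + 27 * B ^ 2 ≠ 0 → ∀ (a : ℚ), 0 < a → ∀ (r : IntegralRep 1), r.domain = {x | 0 < x 0 ^ 3 + (A : ℝ) * x 0 + (B : ℝ)} → EqOn r.integrand (fun x => (a : ℝ) / Real.sqrt (x 0 ^ 3 + (A : ℝ) * x 0 + (B : ℝ))) r.domain → ∃ (e : ℝ) (c : ℚ) (r₁ : IntegralRep 1), e ^ 3 + (A : ℝ) * e + (B : ℝ) = 0 ∧ (∀ x : ℝ, e < x → 0 < x ^ 3 + (A : ℝ) * x +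 (B : ℝ)) ∧ 0 < c ∧ r₁.domain = {x | e < x 0} ∧ EqOn r₁.integrand (fun x => (c : ℝ) / Real.sqrt (x 0 ^ 3 + (A : ℝ) * x 0 + (B : ℝ))) r₁.domain ∧ Equivalent r r₁ := by
  intro A B hΔ a ha r hd hi
  have hΔ' : 4 * (A : ℝ) ^ 3 + 27 * (B : ℝ) ^ 2 ≠ 0 := by exact_mod_cast hΔ
  obtain ⟨e, he, hmax⟩ := exists_max_root (A : ℝ) (B : ℝ)
  have hpos : ∀ x : ℝ, e < x → 0 < x ^ 3 + (A : ℝ) * x + (B : ℝ) :=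
    fun x hx => cubic_pos_of_max_root hmax hx
  rcases roots_dichotomy hΔ' he hmax with hiff | ⟨e₁, e₂, h12, h2e, hfac⟩
  · refine ⟨e, a, r, he, hpos, ha, ?_, hi, Equivalent.refl r⟩
    rw [hd]
    exact Set.ext fun x => hiff (x 0)
  · obtain ⟨r₁, hd₁, hi₁, hE⟩ := exists_reduction_of_three_roots h12 h2e hfac r hd hi
    exact ⟨e, 2 * a, r₁, he, hpos, by positivity, hd₁, hi₁, hE⟩

end Summit.KontsevichZagierPeriods.IsogenyCertificates.RealPeriodSectorCompleteStubs.UnboundedReduction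

end
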